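import Mathlib
import HarnessLib

/-!
# Newman's entire function: the ray bound `‖N‖ ≤ e^{1/e}` far out on every ray

Stub `stub_newmanRayBound` of the line `potential-flow-essential-singularity` for the crux
`MarginalStabilityChain.StretchedVortexRows`.

Newman's entire function is `N(z) = ∫_ℝ K(z, t) dt` with the kernel
`K(z, ζ) = exp(z e^ζ - ζ e^ζ + ζ)` (D. J. Newman, Amer. Math. Monthly 83 (1976) 192–193).
Here `N` is handed to us abstractly through all its shifted-line representations
`N z = ∫_ℝ K(z, τ + iφ) dτ`, `|φ| < π/2` (hypothesis `hrot`).

Proof outline.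
* On the line `Im ζ = φ` the kernel has modulus `exp(e^τ((Re z - τ) cos φ - (Im z - φ) sin φ) + τ)`
  (`newmanRayBound_kernel_norm`).
* If `A := Re z cos φ - (Im z - φ) sin φ ≤ -1` and `cos φ ≥ 0`, then, since `-τ e^τ ≤ e⁻¹`,
  the modulus is `≤ e^{1/e} · exp(-e^τ + τ)` (`newmanRayBound_kernel_le`), and
  `∫_ℝ exp(-e^τ + τ) dτ = 1` (antiderivative `-exp(-e^τ)`), whence `‖N z‖ ≤ e^{1/e}`
  (`newmanRayBound_norm_le`).
* Geometry from a base point `c` with `Im c = 4`: for `z = c + R e^{iθ}` one has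
  `A = R cos(θ + φ) + A₀(φ)`.  If `cos θ ≠ 1`, reduce `θ` modulo `2π` to `θ' ∈ (0, 2π)` and take
  `φ = π/2 - θ'/2`, so that `cos(θ + φ) = -sin(θ'/2) < 0` and `A ≤ -1` for `R` large.  If
  `cos θ = 1` (`z = c + R`), take for each `R` the angle `φ = arccos(1 / max(Re c + R, 2)) ∈ [π/3, π/2)`,
  for which `(Re c + R) cos φ ≤ 1` and `(4 - φ) sin φ > 2`; this is where `Im c = 4` is used.
-/

set_option linter.dupNamespace false

noncomputable section

open scoped Topology ENNReal Real
open Filter Set Function MeasureTheory Complex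

namespace Summit.AnomalousDissipation.AnomalousDissipation.Theorems
namespace MarginalStabilityChainStretchedVortexRows
namespace PotentialFlow

/-- Modulus of Newman's kernel on the shifted line `Im ζ = φ`:
`‖K(z, τ + iφ)‖ = exp(e^τ((Re z - τ) cos φ - (Im z - φ) sin φ) + τ)`. [folklore] -/
theorem newmanRayBound_kernel_norm (z : ℂ) (τ φ : ℝ) :
    ‖Complex.exp (z * Complex.exp ((τ : ℂ) + φ * I) -
        ((τ : ℂ) + φ * I) * Complex.exp ((τ : ℂ) + φ * I) + ((τ : ℂ) + φ * I))‖ =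
      Real.exp (Real.exp τ * ((z.re - τ) * Real.cos φ - (z.im - φ) * Real.sin φ) + τ) := by
  rw [Complex.norm_exp]
  congr 1
  simp only [Complex.add_re, Complex.sub_re, Complex.mul_re, Complex.mul_im, Complex.add_im,
    Complex.ofReal_re, Complex.ofReal_im, Complex.I_re, Complex.I_im, Complex.exp_re,
    Complex.exp_im, mul_zero, mul_one, sub_zero, add_zero, zero_add]
  ring

/-- The elementary inequality `-τ e^τ ≤ e⁻¹` (tangent line of `exp` at `-1`). [folklore] -/
theorem newmanRayBound_neg_mul_exp_le (τ : ℝ) : -τ * Real.exp τ ≤ Real.exp (-1) := by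
  have h := Real.add_one_le_exp (-τ - 1)
  have h' : Real.exp (-τ - 1) * Real.exp τ = Real.exp (-1) := by
    rw [← Real.exp_add]
    congr 1
    ring
  have h2 := mul_le_mul_of_nonneg_right h (Real.exp_pos τ).le
  rw [h'] at h2
  linarith

/-- If `A := Re z cos φ - (Im z - φ) sin φ ≤ -1` and `cos φ ≥ 0`, Newman's kernel on the line
`Im ζ = φ` is dominated by `e^{1/e} · exp(-e^τ + τ)`. [folklore] -/
theorem newmanRayBound_kernel_le (z : ℂ) (τ φ : ℝ) (hcos : 0 ≤ Real.cos φ)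
    (hA : z.re * Real.cos φ - (z.im - φ) * Real.sin φ ≤ -1) :
    ‖Complex.exp (z * Complex.exp ((τ : ℂ) + φ * I) -
        ((τ : ℂ) + φ * I) * Complex.exp ((τ : ℂ) + φ * I) + ((τ : ℂ) + φ * I))‖ ≤
      Real.exp (Real.exp (-1)) * Real.exp (-Real.exp τ + τ) := by
  rw [newmanRayBound_kernel_norm, ← Real.exp_add]
  apply Real.exp_le_exp.mpr
  have hEA : Real.exp τ * (z.re * Real.cos φ - (z.im - φ) * Real.sin φ) ≤ Real.exp τ * (-1) :=
    mul_le_mul_of_nonneg_left hA (Real.exp_pos τ).le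
  have hPC : (-τ * Real.exp τ) * Real.cos φ ≤ Real.exp (-1) * Real.cos φ :=
    mul_le_mul_of_nonneg_right (newmanRayBound_neg_mul_exp_le τ) hcos
  have hQC : Real.exp (-1) * Real.cos φ ≤ Real.exp (-1) * 1 :=
    mul_le_mul_of_nonneg_left (Real.cos_le_one φ) (Real.exp_pos _).le
  nlinarith [hEA, hPC, hQC]

/-- The antiderivative `τ ↦ -exp(-e^τ)` of `τ ↦ exp(-e^τ + τ)`. [folklore] -/
theorem newmanRayBound_hasDerivAt (τ : ℝ) :
    HasDerivAt (fun t : ℝ => -Real.exp (-Real.exp t)) (Real.exp (-Real.exp τ + τ)) τ := by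
  have h : HasDerivAt (fun t : ℝ => -Real.exp (-Real.exp t))
      (-(Real.exp (-Real.exp τ) * -Real.exp τ)) τ :=
    ((Real.hasDerivAt_exp τ).fun_neg.exp).fun_neg
  convert h using 1
  rw [Real.exp_add]
  ring

/-- `-exp(-e^τ) → 0` as `τ → +∞`. [folklore] -/
theorem newmanRayBound_tendsto_atTop :
    Tendsto (fun t : ℝ => -Real.exp (-Real.exp t)) atTop (𝓝 0) := by
  have h1 : Tendsto (fun t : ℝ => -Real.exp t) atTop atBot :=
    tendsto_neg_atTop_atBot.comp Real.tendsto_exp_atTop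
  have h2 : Tendsto (fun t : ℝ => Real.exp (-Real.exp t)) atTop (𝓝 0) :=
    Real.tendsto_exp_atBot.comp h1
  simpa using h2.neg

/-- `-exp(-e^τ) → -1` as `τ → -∞`. [folklore] -/
theorem newmanRayBound_tendsto_atBot :
    Tendsto (fun t : ℝ => -Real.exp (-Real.exp t)) atBot (𝓝 (-1)) := by
  have h1 : Tendsto (fun t : ℝ => -Real.exp t) atBot (𝓝 (-0)) := Real.tendsto_exp_atBot.neg
  have h2 : Tendsto (fun t : ℝ => Real.exp (-Real.exp t)) atBot (𝓝 (Real.exp (-0))) := h1.rexp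
  simpa using h2.neg

/-- `τ ↦ exp(-e^τ + τ)` is integrable on `ℝ`. [folklore] -/
theorem newmanRayBound_integrable :
    Integrable (fun t : ℝ => Real.exp (-Real.exp t + t)) := by
  have h1 : IntegrableOn (fun t : ℝ => Real.exp (-Real.exp t + t)) (Ioi 0) :=
    integrableOn_Ioi_deriv_of_nonneg' (fun t _ => newmanRayBound_hasDerivAt t)
      (fun t _ => (Real.exp_pos _).le) newmanRayBound_tendsto_atTop
  have h2 : IntegrableOn (fun t : ℝ => Real.exp (-Real.exp t + t)) (Iic 0) := by
    refine Integrable.mono' (integrableOn_exp_Iic 0) ?_ ?_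
    · exact (by fun_prop : Continuous fun t : ℝ => Real.exp (-Real.exp t + t)).aestronglyMeasurable
    · refine ae_restrict_of_forall_mem measurableSet_Iic (fun t _ => ?_)
      rw [Real.norm_eq_abs, abs_of_pos (Real.exp_pos _)]
      exact Real.exp_le_exp.mpr (by linarith [Real.exp_pos t])
  have := h2.union h1
  rwa [Iic_union_Ioi, integrableOn_univ] at this

/-- `∫_ℝ exp(-e^τ + τ) dτ = 1` (substitution `s = e^τ`: this is `∫₀^∞ e^{-s} ds`). [folklore] -/
theorem newmanRayBound_integral_eq_one :
    ∫ t : ℝ, Real.exp (-Real.exp t + t) = 1 := by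
  have := integral_of_hasDerivAt_of_tendsto (fun t => newmanRayBound_hasDerivAt t)
    newmanRayBound_integrable newmanRayBound_tendsto_atBot newmanRayBound_tendsto_atTop
  rw [this]
  norm_num

/-- Key analytic step: if `N` has the shifted-line representation on `Im ζ = φ`, `|φ| < π/2`, and
`Re z cos φ - (Im z - φ) sin φ ≤ -1`, then `‖N z‖ ≤ e^{1/e}`. [folklore] -/
theorem newmanRayBound_norm_le (N : ℂ → ℂ)
    (hrot : ∀ φ : ℝ, φ ∈ Set.Ioo (-(π / 2)) (π / 2) → ∀ z : ℂ,
      N z = ∫ τ : ℝ, Complex.exp (z * Complex.exp ((τ : ℂ) + φ * I) -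
        ((τ : ℂ) + φ * I) * Complex.exp ((τ : ℂ) + φ * I) + ((τ : ℂ) + φ * I)))
    (z : ℂ) (φ : ℝ) (hφ : φ ∈ Set.Ioo (-(π / 2)) (π / 2))
    (hA : z.re * Real.cos φ - (z.im - φ) * Real.sin φ ≤ -1) :
    ‖N z‖ ≤ Real.exp (Real.exp (-1)) := by
  rw [hrot φ hφ z]
  have hcos : 0 < Real.cos φ := Real.cos_pos_of_mem_Ioo hφ
  calc ‖∫ τ : ℝ, Complex.exp (z * Complex.exp ((τ : ℂ) + φ * I) -
          ((τ : ℂ) + φ * I) * Complex.exp ((τ : ℂ) + φ * I) + ((τ : ℂ) + φ * I))‖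
        ≤ ∫ τ : ℝ, Real.exp (Real.exp (-1)) * Real.exp (-Real.exp τ + τ) :=
          norm_integral_le_of_norm_le (newmanRayBound_integrable.const_mul _)
            (ae_of_all _ (fun τ => newmanRayBound_kernel_le z τ φ hcos.le hA))
    _ = Real.exp (Real.exp (-1)) := by
          rw [integral_const_mul, newmanRayBound_integral_eq_one, mul_one]

/-- **Ray bound for Newman's function.** If `N` admits the shifted-line representations
`N z = ∫_ℝ K(z, τ + iφ) dτ` for all `|φ| < π/2`, then from every base point `c` with `Im c = 4`,
along every ray `c + R e^{iθ}`, eventually `‖N‖ ≤ e^{1/e}`. [folklore] -/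
theorem stub_newmanRayBound (N : ℂ → ℂ)
    (hrot : ∀ φ : ℝ, φ ∈ Set.Ioo (-(π / 2)) (π / 2) → ∀ z : ℂ,
      N z = ∫ τ : ℝ, Complex.exp (z * Complex.exp ((τ : ℂ) + φ * I) -
        ((τ : ℂ) + φ * I) * Complex.exp ((τ : ℂ) + φ * I) + ((τ : ℂ) + φ * I)))
    (c : ℂ) (hc : c.im = 4) (θ : ℝ) :
    ∃ R₀ : ℝ, ∀ R : ℝ, R₀ ≤ R →
      ‖N (c + R * Complex.exp (θ * I))‖ ≤ Real.exp (Real.exp (-1)) := by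
  have hre : ∀ R : ℝ, (c + R * Complex.exp (θ * I)).re = c.re + R * Real.cos θ := by
    intro R
    simp [Complex.exp_ofReal_mul_I_re, Complex.exp_ofReal_mul_I_im]
  have him : ∀ R : ℝ, (c + R * Complex.exp (θ * I)).im = 4 + R * Real.sin θ := by
    intro R
    simp [Complex.exp_ofReal_mul_I_re, Complex.exp_ofReal_mul_I_im, hc]
  by_cases hcos : Real.cos θ = 1
  · -- the ray is the rightward horizontal ray `z = c + R`
    have hsin : Real.sin θ = 0 := Real.sin_eq_zero_iff_cos_eq.mpr (Or.inl hcos)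
    refine ⟨0, fun R _ => ?_⟩
    have hmax : (2 : ℝ) ≤ max (c.re + R) 2 := le_max_right _ _
    obtain ⟨m, hm⟩ : ∃ m : ℝ, m = 1 / max (c.re + R) 2 := ⟨_, rfl⟩
    have hm0 : 0 < m := by rw [hm]; exact one_div_pos.mpr (by linarith)
    have hm2 : m ≤ 1 / 2 := by rw [hm]; exact one_div_le_one_div_of_le (by norm_num) hmax
    have hXm : (c.re + R) * m ≤ 1 := by
      rw [hm, mul_one_div]
      exact (div_le_one (by linarith)).mpr (le_max_left _ _)
    obtain ⟨φ, hφ⟩ : ∃ φ : ℝ, φ = Real.arccos m := ⟨_, rfl⟩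
    have hφcos : Real.cos φ = m := by rw [hφ]; exact Real.cos_arccos (by linarith) (by linarith)
    have hφlt : φ < π / 2 := by rw [hφ]; exact Real.arccos_lt_pi_div_two.mpr hm0
    have hφpos : 0 < φ := by rw [hφ]; exact Real.arccos_pos.mpr (by linarith)
    have hφpi : φ ≤ π := by rw [hφ]; exact Real.arccos_le_pi m
    have hsφ : 0 ≤ Real.sin φ := Real.sin_nonneg_of_nonneg_of_le_pi hφpos.le hφpi
    have hsφ2 : 3 / 4 ≤ Real.sin φ ^ 2 := by
      have := Real.sin_sq_add_cos_sq φ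
      rw [hφcos] at this
      nlinarith
    have hs85 : 0.85 ≤ Real.sin φ := by nlinarith [hsφ, hsφ2]
    have hd : 2.425 ≤ 4 - φ := by linarith [Real.pi_lt_d2]
    refine newmanRayBound_norm_le N hrot _ φ ⟨by linarith [Real.pi_pos], hφlt⟩ ?_
    rw [hre, him, hcos, hsin, hφcos]
    have hprod : (2.425 : ℝ) * 0.85 ≤ (4 - φ) * Real.sin φ :=
      mul_le_mul hd hs85 (by norm_num) (by linarith)
    nlinarith [hprod, hXm]
  · -- a genuine direction `θ ∉ 2πℤ`: one fixed shifted line works for all large `R`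
    obtain ⟨k, hk1, hk2⟩ : ∃ k : ℤ, (k : ℝ) * (2 * π) ≤ θ ∧ θ < ((k : ℝ) + 1) * (2 * π) := by
      refine ⟨⌊θ / (2 * π)⌋, ?_, ?_⟩
      · have := Int.floor_le (θ / (2 * π))
        rwa [le_div_iff₀ Real.two_pi_pos] at this
      · have := Int.lt_floor_add_one (θ / (2 * π))
        rwa [div_lt_iff₀ Real.two_pi_pos] at this
    obtain ⟨θ', hθ'⟩ : ∃ θ' : ℝ, θ = θ' + k * (2 * π) := ⟨θ - k * (2 * π), by ring⟩
    have hθ'0 : 0 ≤ θ' := by linarith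
    have hθ'lt : θ' < 2 * π := by linarith
    have hθ'pos : 0 < θ' := by
      rcases hθ'0.lt_or_eq with h | h
      · exact h
      · exact absurd (by rw [hθ', ← h, zero_add]; exact Real.cos_int_mul_two_pi k) hcos
    obtain ⟨φ, hφ⟩ : ∃ φ : ℝ, φ = π / 2 - θ' / 2 := ⟨_, rfl⟩
    have hφmem : φ ∈ Set.Ioo (-(π / 2)) (π / 2) := by
      constructor <;> linarith
    have hκ : Real.cos (θ + φ) = -Real.sin (θ' / 2) := by
      rw [show θ + φ = (θ' / 2 + π / 2) + k * (2 * π) by rw [hθ', hφ]; ring,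
        Real.cos_add_int_mul_two_pi, Real.cos_add_pi_div_two]
    have hsinpos : 0 < Real.sin (θ' / 2) :=
      Real.sin_pos_of_pos_of_lt_pi (by linarith) (by linarith)
    refine ⟨(1 + |c.re * Real.cos φ - (4 - φ) * Real.sin φ|) / Real.sin (θ' / 2),
      fun R hR => ?_⟩
    refine newmanRayBound_norm_le N hrot _ φ hφmem ?_
    rw [hre, him]
    have h1 : 1 + |c.re * Real.cos φ - (4 - φ) * Real.sin φ| ≤ R * Real.sin (θ' / 2) :=
      (div_le_iff₀ hsinpos).mp hR
    have hexp : (c.re + R * Real.cos θ) * Real.cos φ - (4 + R * Real.sin θ - φ) * Real.sin φ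
        = R * Real.cos (θ + φ) + (c.re * Real.cos φ - (4 - φ) * Real.sin φ) := by
      rw [Real.cos_add]
      ring
    rw [hexp, hκ]
    linarith [le_abs_self (c.re * Real.cos φ - (4 - φ) * Real.sin φ)]

end PotentialFlow
end MarginalStabilityChainStretchedVortexRows
end Summit.AnomalousDissipation.AnomalousDissipation.Theorems
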